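import Summits.ABC.ABC.Theorems.TwistAmplificationSharpModerateLawCuspDispersionTwDefs

/-!
# Crux `TwistAmplification.SharpModerateLaw` (stmt-ABC-1975), line `deep-moduli-cusp-dispersion`:
the resolved regime's open core as a conductor-free class sum (definitions only)

Worker W3 of lead `prover-line-stmt-ABC-1975-c1-0`, 2026-08-16. Companion to `…CuspDispersionTwDefs.lean`.

The reshaped stub `stub_resolvedRegime : CuspSumBound → CuspSumBound23 → LawOn ResolvedRegimeTw` is open (no engine
in print: it needs optimal cancellation in incomplete two-variable cusp sums to powerful moduli at `u`-length
`e^{2/5} … e^{1/2}`). This file NAMES its open core in the form a dispersion argument actually consumes: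

* `BoundedRadicalCount`, `PowerfulInvRadicalSum` — the two Rankin-type class-count facts, VERBATIM the statements
  registered as `boundedRadicalCount_holds` / `powerfulInvRadicalSum_holds` (worker W8 discharges them by `exact`);
* `tube Y L` — the cusp-excised dyadic tube (the archimedean part of `cuspSetD`, discriminant window `1728·L`),
  `cuspBox Y` — `cuspSetD X Y` with the conductor clause `N* ≤ X` removed (`= tube Y Y ∧ 1728 ∣ u³−v² ∧ TF`);
* `resolvedClass e g X Y` — the CLASS of the dispersion datum `(e, g)`: `e` = dispersion modulus (a divisor, prime to
  `u`, of the `u`-coprime part `c` of `Δ = (u³−v²)/1728`, so that `(u,v) ≡ (t²,t³) mod e` by `cuspParam`), `g` = the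
  additive part of `Δ` (`Δ = g·c`, `(u,c) = 1`, every prime of `g` divides `u`; twists `(d²u₀,d³v₀)` are the case
  `p ∣ g` with `p⁶ ∣ g`), cut by the two ARCHIMEDEAN inequalities that replace `r' ≥ Y^{1/6}` and `N* ≤ X` inside a
  class: `Y^{1/6}·e·g ≤ |Δ|` and `|Δ|·rad e·(rad g)² ≤ e·g·X` — no conductor appears;
* `ResolvedMissingTw` — THE NAMED OPEN CORE: the sum over powerful `e ≤ Y` and `g ≤ Y` of `#resolvedClass e g X Y`
  obeys the law `C X^ε (X·Y^{-1/6} + 1)` on the cone `X³ ≤ 8Y ≤ 8X^σ`.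

Directions. `ResolvedMissingTw → LawOn ResolvedRegimeTw` is PROVED (kernel-checked, file
`…SharpModerateLawResolvedReduction.lean`, theorem `lawOn_resolvedRegimeTw_of_missing`: every resolved pair lies in the
class of its own datum `(e, g)` = (powerful part of the `u`-coprime part of `Δ`, `u`-part of `Δ`), where the two
archimedean inequalities are `r'·e·g ≤ |Δ|`-type identities and `N* = s·rad e·(rad g)²`). Conversely every member of
every class has `N* ≤ rad e·(rad g)²·|Δ|/(e g) ≤ X`, so each class is a subset of the resolved set at the SAME scales and
`LawOn ResolvedRegimeTw` gives `ResolvedMissingTw` back up to the multiplicity `max_x #{(e,g)} ≤ d(|Δ|)² = X^{o(1)}`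
(paper, not formalised): the named core is EQUIVALENT to the regime law up to `X^ε`, i.e. it is not a stronger bet.
What a proof of `ResolvedMissingTw` must supply, class by class, is the optimal count
`#resolvedClass e g X Y ≪ X^ε·(X·Y^{-1/6}/rad e)·∏_{p ∣ g} O(1)/p` (expected value: tube area `≍ L·Y^{-1/6}`,
`L = e g X/(rad e·(rad g)²)`, times the density `φ(e)/e²·∏_{p^k ∥ g} O(p^{1−k})`), summed with `PowerfulInvRadicalSum`
(`Σ_e 1/rad e = Y^{o(1)}`, de Bruijn) and `BoundedRadicalCount`; plain completion with `CuspSumBound(23)` loses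
`Y^{1/6} … Y^{5/12}` on every class (analysis `ResolvedRegime-analysis.md` of W3, evidence on the item).
-/

noncomputable section

namespace Summit.ABC.ABC.Theorems.SharpModerateLaw.CuspDispersion

open scoped BigOperators

/-! ## 1. The two Rankin-type class-count facts (verbatim the registered helper statements) -/

/-- **Bounded-radical count** (Rankin / Robert–Tenenbaum shape): `#{e ≤ T : rad e ≤ Q} ≤ C_δ·Q^{1+δ}·T^δ`.
Verbatim the registered `boundedRadicalCount_holds`. -/
def BoundedRadicalCount : Prop :=
  ∀ δ : ℝ, 0 < δ → ∃ C : ℝ, ∀ T Q : ℝ, 1 ≤ T → 1 ≤ Q →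
    ((((Finset.Icc 1 ⌊T⌋₊).filter (fun e : ℕ => ((∏ p ∈ e.primeFactors, p : ℕ) : ℝ) ≤ Q)).card : ℕ) : ℝ) ≤
      C * Q ^ (1 + δ) * T ^ δ

/-- **Powerful inverse-radical sum** (de Bruijn shape): `Σ_{e ≤ T powerful} 1/rad e ≤ C_δ·T^δ`.
Verbatim the registered `powerfulInvRadicalSum_holds`. -/
def PowerfulInvRadicalSum : Prop :=
  ∀ δ : ℝ, 0 < δ → ∃ C : ℝ, ∀ T : ℝ, 1 ≤ T →
    (∑ e ∈ (Finset.Icc 1 ⌊T⌋₊).filter (fun e : ℕ => ∀ p ∈ e.primeFactors, p ^ 2 ∣ e),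
        (1 : ℝ) / ((∏ p ∈ e.primeFactors, p : ℕ) : ℝ)) ≤ C * T ^ δ

/-! ## 2. Tubes, the conductor-free cusp box, classes -/

/-- The cusp-excised dyadic TUBE at scale `Y` with discriminant window `L`: `uv ≠ 0`, `u³ ≠ v²`, `|u|³ ≤ Y`,
`|u³ − v²| ≤ 1728·L`, and the dyadic floor `Y < 2·max(|u|³, |u³−v²|/1728)` (for `L < Y/3456` the floor forces
`|u|³ > Y/2`; the tube's area is `≍ L·Y^{-1/6}`). -/
def tube (Y L : ℝ) : Set (ℤ × ℤ) :=
  {x | x.1 ≠ 0 ∧ x.2 ≠ 0 ∧ x.1 ^ 3 ≠ x.2 ^ 2 ∧ ((|x.1| ^ 3 : ℤ) : ℝ) ≤ Y ∧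
    ((|x.1 ^ 3 - x.2 ^ 2| : ℤ) : ℝ) ≤ 1728 * L ∧
    Y < 2 * max (((|x.1| ^ 3 : ℤ) : ℝ)) (((|x.1 ^ 3 - x.2 ^ 2| : ℤ) : ℝ) / 1728)}

/-- The conductor-free CUSP BOX at scale `Y`: `cuspSetD X Y` with the clause `N* ≤ X` removed
(`tube Y Y`, `1728 ∣ u³ − v²`, tower-free). -/
def cuspBox (Y : ℝ) : Set (ℤ × ℤ) :=
  {x | x ∈ tube Y Y ∧ (1728 : ℤ) ∣ x.1 ^ 3 - x.2 ^ 2 ∧ TF x}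

/-- The CLASS of the dispersion datum `(e, g)` at scales `(X, Y)`: pairs of the cusp box in the twist-aware resolved
regime with `Δ = (u³−v²)/1728 = g·c`, `(u, c) = 1`, every prime of `g` dividing `u` (so `g` is exactly the additive
part of `Δ`), `e ∣ c` (the dispersion modulus: `(u,e) = 1`, `e ∣ u³ − v²`, hence `(u,v) ≡ (t²,t³) mod e`), inside the
ANNULAR tube `Y^{1/6}·e·g ≤ |Δ| ≤ e·g·X/(rad e·(rad g)²)` — the two archimedean inequalities that stand in for
`r' ≥ Y^{1/6}` and `N* ≤ X` (for a member, `N* = rad c·(rad g)² ≤ rad e·(|c|/e)·(rad g)² ≤ X`). -/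
def resolvedClass (e g : ℕ) (X Y : ℝ) : Set (ℤ × ℤ) :=
  {x | x ∈ cuspBox Y ∧ ResolvedRegimeTw Y x ∧ (∀ p ∈ g.primeFactors, (p : ℤ) ∣ x.1) ∧
    (∃ c : ℤ, (x.1 ^ 3 - x.2 ^ 2) / 1728 = g * c ∧ IsCoprime x.1 c ∧ (e : ℤ) ∣ c) ∧
    Y ^ (1 / 6 : ℝ) * (e : ℝ) * (g : ℝ) ≤ ((|x.1 ^ 3 - x.2 ^ 2| : ℤ) : ℝ) / 1728 ∧
    ((|x.1 ^ 3 - x.2 ^ 2| : ℤ) : ℝ) / 1728 * ((∏ p ∈ e.primeFactors, p : ℕ) : ℝ) *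
        ((∏ p ∈ g.primeFactors, p : ℕ) : ℝ) ^ 2 ≤ (e : ℝ) * (g : ℝ) * X}

/-! ## 3. The named open core of `stub_resolvedRegime` -/

/-- **`ResolvedMissingTw`** — the resolved regime's law as a CONDUCTOR-FREE CLASS SUM: for `σ > 6`, `ε > 0` there is
`C` with, on the cone `X, Y ≥ 1`, `X³ ≤ 8Y`, `Y ≤ X^σ`,
`Σ_{e ≤ Y powerful} Σ_{g ≤ Y} #resolvedClass e g X Y ≤ C·X^ε·(X·Y^{-1/6} + 1)`.
PROVED in the tree: `ResolvedMissingTw → LawOn ResolvedRegimeTw` (`lawOn_resolvedRegimeTw_of_missing`); the converse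
holds up to `X^ε` (each class sits inside the resolved set at the same scales; multiplicity `≤ d(|Δ|)²`), so this is
EQUIVALENT to the regime law up to `X^ε` — the honest open core, not a stronger conjecture. Class by class it asks for
the optimal count `≪ X^ε·X·Y^{-1/6}/rad e·∏_{p ∣ g} O(1)/p` of cusp-congruence points `(t²,t³) mod e`, `u ≡ 0 (rad g)`,
`g ∣ Δ`, in an annular dyadic tube whose `v`-window is shorter than the modulus `e` (sub-Pólya–Vinogradov). -/
def ResolvedMissingTw : Prop :=
  ∀ σ : ℝ, 6 < σ → ∀ ε : ℝ, 0 < ε → ∃ C : ℝ, ∀ X Y : ℝ, 1 ≤ X → 1 ≤ Y → X ^ 3 ≤ 8 * Y → Y ≤ X ^ σ →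
    (∑ e ∈ (Finset.Icc 1 ⌊Y⌋₊).filter (fun e : ℕ => ∀ p ∈ e.primeFactors, p ^ 2 ∣ e),
      ∑ g ∈ Finset.Icc 1 ⌊Y⌋₊, (Set.ncard (resolvedClass e g X Y) : ℝ)) ≤
      C * X ^ ε * (X * Y ^ (-(1 / 6 : ℝ)) + 1)

/-- `ResolvedMissingTw` unfolded (registration anchor of this definitions file; `Iff.rfl`). -/
theorem resolvedMissingTw_iff :
    ResolvedMissingTw ↔
      ∀ σ : ℝ, 6 < σ → ∀ ε : ℝ, 0 < ε → ∃ C : ℝ, ∀ X Y : ℝ, 1 ≤ X → 1 ≤ Y → X ^ 3 ≤ 8 * Y → Y ≤ X ^ σ →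
        (∑ e ∈ (Finset.Icc 1 ⌊Y⌋₊).filter (fun e : ℕ => ∀ p ∈ e.primeFactors, p ^ 2 ∣ e),
          ∑ g ∈ Finset.Icc 1 ⌊Y⌋₊, (Set.ncard (resolvedClass e g X Y) : ℝ)) ≤
          C * X ^ ε * (X * Y ^ (-(1 / 6 : ℝ)) + 1) :=
  Iff.rfl

end Summit.ABC.ABC.Theorems.SharpModerateLaw.CuspDispersion

end
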